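import Mathlib
import Summits.KontsevichZagierPeriods.Zeta5Search.WedgeDictionaryConsequences
import HarnessLib

/-!
# The wedge-square dictionary: the partner shift on partial-fraction data and the j-free quadratic form `M₃`

Cell `pub-zeta5` (HONEST FRAMING: systematic search; no irrationality claim unless certified), typer seat
generation 3.  OUR work (Summit side).  This file PROVES the "j-FREE FORM" (f) of the planner seat's
`DICTIONARY.md` §2 — the shape a proof of the conjecture's `Q`-part should target:

* `IsPFData.shift` — THE partial-fraction data of `R_{b+e_j}` in terms of the data `c` of `R_b`: multiplying the
  Laurent expansions by `(t+1+b_j)(t+1+b₀−b_j) = u² + S_p u + P_p` (`u = t+p+1`, `S_p = b₀ − 2p`,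
  `P_p = p² − b₀p + b_j(b₀−b_j)`) gives `c^{(j)}_{o,p} = c_{o+2,p} + S_p c_{o+1,p} + P_p c_{o,p}` (orders `≥ 6` read as `0`);
  the would-be polynomial part `t·Σ_p c_{0,p} + Σ_p (c_{1,p} + (b₀+1−p)c_{0,p})` vanishes (first sum by
  `sum_pf_data_zero`, the constant because `R_{b+e_j} → 0` at infinity, `pfEval_tendsto_zero`), and uniqueness of
  partial fractions concludes;
* `coeffU_update`, `coeffW_update` — hence `U(b+e_j) = Σ_p S_p c_{5,p} + Σ_p (p²−b₀p) c_{4,p} + κ_j U(b)` and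
  `W(b+e_j) = U(b) + Σ_p S_p c_{3,p} + Σ_p (p²−b₀p) c_{2,p} + κ_j W(b)`, `κ_j = b_j(b₀−b_j)`;
* `quadM3` and `wedgeQ_eq_quadM3` — the minor is a QUADRATIC functional of the data of the single rational function
  `R_b`:  `U(b)W(b+e_j) − U(b+e_j)W(b) = M₃(b) := U² + U·Σ_p(S_p c_{3,p} + (p²−b₀p)c_{2,p}) − W·Σ_p(S_p c_{5,p} + (p²−b₀p)c_{4,p})`
  (independent of `j`, re-proving `wedgeQ_partner_independent`);
* `Q_part_iff_quadM3` — on its region, the `Q`-part of `wedgeDictionary` reads `Q(a) = ρ(a)·M₃(b(a))`: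
  "the binomial double sum (17) equals `ρ` times a quadratic functional of the partial fractions of `R_{b(a)}`".
-/

noncomputable section

open Finset Polynomial Filter Topology

namespace Summit.KontsevichZagierPeriods.Zeta5Search.WedgeDictionary

open Summit.KontsevichZagierPeriods.Zeta5Search.DualSeries
open Literature.NumberTheory.Irrationality.BrownZudilin2022 (vwpDual bOfA Converges cellularIntegral QOf)
open Literature.NumberTheory.Irrationality.CressonFischlerRivoal2008 (sum_pf_data_zero)
open Literature.NumberTheory.Transcendental (zetaValue)
open Literature.NumberTheory.Transcendental.BallRivoal (pfEval pf_unique pfEval_sub' tendsto_mul_pfEval)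

/-! ### The shifted data -/

/-- Truncation of data to the orders `< 6` that `pfEval _ 6` reads. -/
def cut (c : ℕ → ℕ → ℚ) : ℕ → ℕ → ℚ := fun o p => if o < 6 then c o p else 0

/-- The data of `R_b(t)·(t+1+β)(t+1+γ)` in terms of the data `c` of `R_b`:
`c'_{o,p} = c_{o+2,p} + (β+γ−2p)·c_{o+1,p} + (β−p)(γ−p)·c_{o,p}` (orders `≥ 6` of `c` read as `0`). -/
def shiftData (β γ : ℚ) (c : ℕ → ℕ → ℚ) : ℕ → ℕ → ℚ := fun o p =>
  cut c (o + 2) p + (β + γ - 2 * p) * cut c (o + 1) p + (β - p) * (γ - p) * cut c o p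

/-- `c'_0 = c_2 + S c_1 + P c_0`. -/
theorem shiftData_zero (β γ : ℚ) (c : ℕ → ℕ → ℚ) (p : ℕ) :
    shiftData β γ c 0 p = c 2 p + (β + γ - 2 * p) * c 1 p + (β - p) * (γ - p) * c 0 p := by
  simp [shiftData, cut]

/-- `c'_1 = c_3 + S c_2 + P c_1`. -/
theorem shiftData_one (β γ : ℚ) (c : ℕ → ℕ → ℚ) (p : ℕ) :
    shiftData β γ c 1 p = c 3 p + (β + γ - 2 * p) * c 2 p + (β - p) * (γ - p) * c 1 p := by
  simp [shiftData, cut]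

/-- `c'_2 = c_4 + S c_3 + P c_2`. -/
theorem shiftData_two (β γ : ℚ) (c : ℕ → ℕ → ℚ) (p : ℕ) :
    shiftData β γ c 2 p = c 4 p + (β + γ - 2 * p) * c 3 p + (β - p) * (γ - p) * c 2 p := by
  simp [shiftData, cut]

/-- `c'_3 = c_5 + S c_4 + P c_3`. -/
theorem shiftData_three (β γ : ℚ) (c : ℕ → ℕ → ℚ) (p : ℕ) :
    shiftData β γ c 3 p = c 5 p + (β + γ - 2 * p) * c 4 p + (β - p) * (γ - p) * c 3 p := by
  simp [shiftData, cut]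

/-- `c'_4 = S c_5 + P c_4` (order `6` of `c` reads `0`). -/
theorem shiftData_four (β γ : ℚ) (c : ℕ → ℕ → ℚ) (p : ℕ) :
    shiftData β γ c 4 p = (β + γ - 2 * p) * c 5 p + (β - p) * (γ - p) * c 4 p := by
  simp [shiftData, cut]

/-- `c'_5 = P c_5` (orders `6, 7` of `c` read `0`). -/
theorem shiftData_five (β γ : ℚ) (c : ℕ → ℕ → ℚ) (p : ℕ) :
    shiftData β γ c 5 p = (β - p) * (γ - p) * c 5 p := by
  simp [shiftData, cut]

/-- One pole: `(Σ_{o<6} c_o u^{-(o+1)})·(u² + Su + P) = Σ_{o<6} c'_o u^{-(o+1)} + (c₀u + Sc₀ + c₁)`. -/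
theorem laurent_shift (c0 c1 c2 c3 c4 c5 u S P : ℚ) (hu : u ≠ 0) :
    (c0 / u + c1 / u ^ 2 + c2 / u ^ 3 + c3 / u ^ 4 + c4 / u ^ 5 + c5 / u ^ 6) * (u ^ 2 + S * u + P) =
      ((c2 + S * c1 + P * c0) / u + (c3 + S * c2 + P * c1) / u ^ 2 + (c4 + S * c3 + P * c2) / u ^ 3 +
          (c5 + S * c4 + P * c3) / u ^ 4 + (S * c5 + P * c4) / u ^ 5 + (P * c5) / u ^ 6) +
        (c0 * u + S * c0 + c1) := by
  field_simp
  ring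

/-- Summed over the poles: `pfEval c · (t+1+β)(t+1+γ) = pfEval c' + Σ_p (c_{0,p}·t + (c_{1,p} + (β+γ+1−p)c_{0,p}))`. -/
theorem pfEval_mul_quadratic (n : ℕ) (c : ℕ → ℕ → ℚ) (β γ t : ℚ) (ht : ∀ p, p ≤ n → t + p + 1 ≠ 0) :
    pfEval n 6 c t * ((t + 1 + β) * (t + 1 + γ)) =
      pfEval n 6 (shiftData β γ c) t +
        ∑ p ∈ range (n + 1), (c 0 p * t + (c 1 p + (β + γ + 1 - p) * c 0 p)) := by
  unfold pfEval
  rw [sum_mul, ← sum_add_distrib]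
  refine sum_congr rfl fun p hp => ?_
  have hu : t + p + 1 ≠ 0 := ht p (Nat.lt_succ_iff.1 (mem_range.1 hp))
  have hΦ : (t + 1 + β) * (t + 1 + γ) =
      (t + p + 1) ^ 2 + (β + γ - 2 * p) * (t + p + 1) + (β - p) * (γ - p) := by ring
  rw [hΦ]
  simp only [sum_range_succ, sum_range_zero, zero_add, shiftData_zero, shiftData_one, shiftData_two,
    shiftData_three, shiftData_four, shiftData_five]
  try simp only [pow_one]
  linear_combination laurent_shift (c 0 p) (c 1 p) (c 2 p) (c 3 p) (c 4 p) (c 5 p) (t + p + 1)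
    (β + γ - 2 * p) ((β - p) * (γ - p)) hu

/-- `pfEval` data tend to `0` along the naturals. -/
theorem pfEval_tendsto_zero (n K : ℕ) (c : ℕ → ℕ → ℚ) :
    Tendsto (fun k : ℕ => (pfEval n K c k : ℝ)) atTop (𝓝 0) := by
  have h1 := tendsto_mul_pfEval n K c
  have h2 : Tendsto (fun k : ℕ => ((k : ℝ) * (pfEval n K c k : ℝ)) / (k : ℝ)) atTop (𝓝 0) :=
    h1.div_atTop tendsto_natCast_atTop_atTop
  refine (h2.congr' ?_)
  filter_upwards [eventually_gt_atTop 0] with k hk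
  have hk' : (k : ℝ) ≠ 0 := by positivity
  field_simp

/-- **The partner shift on partial-fraction data.** If `c` is the data of `R_b` and `c'` the data of `R_{b+e_{i+1}}`
(`b` in the box, `d(b) ≥ 0`), then on the grid `c' = shiftData b_{i+1} (b₀−b_{i+1}) c`. -/
theorem IsPFData.shift {b : ℕ → ℤ} (hb : InBox b) (hd : 0 ≤ dOf b) {i : ℕ} (hi : i ∈ range 7)
    {c c' : ℕ → ℕ → ℚ} (hc : IsPFData b c)
    (hc' : IsPFData (Function.update b (i + 1) (b (i + 1) + 1)) c') {o p : ℕ} (ho : o < 6)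
    (hp : p ≤ (b 0).toNat) :
    c' o p = shiftData (b (i + 1) : ℚ) ((b 0 - b (i + 1) : ℤ) : ℚ) c o p := by
  set β : ℚ := (b (i + 1) : ℚ) with hβ
  set γ : ℚ := ((b 0 - b (i + 1) : ℤ) : ℚ) with hγ
  set B := (b 0).toNat with hB
  have h0i : Function.update b (i + 1) (b (i + 1) + 1) 0 = b 0 := Function.update_of_ne (by omega) _ _
  -- the order-zero sum of `c` vanishes (degree condition for `b`)
  have hz : ∑ p ∈ range (B + 1), c 0 p = 0 := by
    have hQnat : ((numPoly b).comp (X + C 1)).natDegree = (numPoly b).natDegree := by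
      rw [natDegree_comp, natDegree_X_add_C, mul_one]
    exact sum_pf_data_zero B 6 (by norm_num) _
      (by rw [hQnat]; exact natDegree_numPoly_add_two_le b hb (sum_le_of_dOf b hd)) c hc
  -- the difference data evaluate to the constant `L`
  set L : ℚ := ∑ p ∈ range (B + 1), (c 1 p + (β + γ + 1 - p) * c 0 p) with hL
  set e : ℕ → ℕ → ℚ := fun o p => c' o p - shiftData β γ c o p with he
  have hev : ∀ t : ℚ, (∀ p, p ≤ B → t + p + 1 ≠ 0) → pfEval B 6 e t = L := by
    intro t ht
    have e1 : pfEval B 6 e t = pfEval B 6 c' t - pfEval B 6 (shiftData β γ c) t := pfEval_sub' _ _ _ _ _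
    have e2 := hc' t (by rw [h0i]; exact ht)
    rw [h0i] at e2
    have e3 : pfEval B 6 c' t = pfEval B 6 c t * ((t + 1 + β) * (t + 1 + γ)) := by
      rw [e2, hc t ht, numPoly_update b hi (hb.2 i hi).1]
      simp only [mul_comp, add_comp, X_comp, C_comp, eval_mul, eval_add, eval_X, eval_C]
      rw [hβ, hγ]
      ring
    have e4 := pfEval_mul_quadratic B c β γ t ht
    have e5 : ∑ p ∈ range (B + 1), (c 0 p * t + (c 1 p + (β + γ + 1 - p) * c 0 p)) = L := by
      rw [sum_add_distrib, ← sum_mul, hz, zero_mul, zero_add]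
    rw [e1, e3, e4, e5]
    ring
  -- `L = 0`: the data `e` tend to zero along the naturals, but are constantly `L` there
  have hL0 : L = 0 := by
    have hpos : ∀ k : ℕ, ∀ p, p ≤ B → (k : ℚ) + p + 1 ≠ 0 := fun k p _ => by positivity
    have h1 := pfEval_tendsto_zero B 6 e
    have h2 : (fun k : ℕ => (pfEval B 6 e k : ℝ)) = fun _ => (L : ℝ) := funext fun k => by rw [hev _ (hpos k)]
    rw [h2] at h1
    have := tendsto_nhds_unique h1 tendsto_const_nhds
    exact_mod_cast this.symm
  -- uniqueness of partial fractions
  have hzero : ∀ t : ℕ, 0 ≤ t → pfEval B 6 e t = 0 := fun t _ => by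
    rw [hev _ (fun p _ => by positivity), hL0]
  have := pf_unique B 6 e 0 hzero o p ho hp
  rw [he] at this
  exact sub_eq_zero.1 this

/-! ### The canonical coefficients of the partner in terms of the data of `b` -/

/-- `U(b+e_{i+1}) = Σ_p (b₀−2p) c_{5,p} + Σ_p (p²−b₀p) c_{4,p} + κ U(b)`, `κ = b_{i+1}(b₀−b_{i+1})`, for ANY data `c` of `R_b`. -/
theorem coeffU_update {b : ℕ → ℤ} (hb : InBox b) (hd : 0 ≤ dOf b) {i : ℕ} (hi : i ∈ range 7)
    (hle : b (i + 1) ≤ b 0) {c : ℕ → ℕ → ℚ} (hc : IsPFData b c) :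
    coeffU (Function.update b (i + 1) (b (i + 1) + 1)) =
      ∑ p ∈ range ((b 0).toNat + 1),
        (((b 0 : ℚ) - 2 * p) * c 5 p + ((p : ℚ) ^ 2 - (b 0 : ℚ) * p) * c 4 p) +
        ((b (i + 1) : ℚ) * (b 0 - b (i + 1))) * coeffU b := by
  obtain ⟨hbox', hsum'⟩ := box_update b hb hd hi hle
  obtain ⟨c', hc'⟩ := exists_isPFData _ hbox' hsum'
  have h0i : Function.update b (i + 1) (b (i + 1) + 1) 0 = b 0 := Function.update_of_ne (by omega) _ _
  rw [coeffU_eq hc', coeffU_eq hc, h0i, mul_sum, ← sum_add_distrib]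
  refine sum_congr rfl fun p hp => ?_
  rw [IsPFData.shift hb hd hi hc hc' (by norm_num) (Nat.lt_succ_iff.1 (mem_range.1 hp)), shiftData_four]
  push_cast
  ring

/-- `W(b+e_{i+1}) = U(b) + Σ_p (b₀−2p) c_{3,p} + Σ_p (p²−b₀p) c_{2,p} + κ W(b)` for ANY data `c` of `R_b`. -/
theorem coeffW_update {b : ℕ → ℤ} (hb : InBox b) (hd : 0 ≤ dOf b) {i : ℕ} (hi : i ∈ range 7)
    (hle : b (i + 1) ≤ b 0) {c : ℕ → ℕ → ℚ} (hc : IsPFData b c) :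
    coeffW (Function.update b (i + 1) (b (i + 1) + 1)) =
      coeffU b + ∑ p ∈ range ((b 0).toNat + 1),
        (((b 0 : ℚ) - 2 * p) * c 3 p + ((p : ℚ) ^ 2 - (b 0 : ℚ) * p) * c 2 p) +
        ((b (i + 1) : ℚ) * (b 0 - b (i + 1))) * coeffW b := by
  obtain ⟨hbox', hsum'⟩ := box_update b hb hd hi hle
  obtain ⟨c', hc'⟩ := exists_isPFData _ hbox' hsum'
  have h0i : Function.update b (i + 1) (b (i + 1) + 1) 0 = b 0 := Function.update_of_ne (by omega) _ _
  rw [coeffW_eq hc', coeffW_eq hc, coeffU_eq hc, h0i, mul_sum, ← sum_add_distrib, ← sum_add_distrib]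
  refine sum_congr rfl fun p hp => ?_
  rw [IsPFData.shift hb hd hi hc hc' (by norm_num) (Nat.lt_succ_iff.1 (mem_range.1 hp)), shiftData_two]
  push_cast
  ring

/-! ### The j-free quadratic form `M₃` -/

/-- `M₃(b) = U² + U·Σ_p((b₀−2p)c_{3,p} + (p²−b₀p)c_{2,p}) − W·Σ_p((b₀−2p)c_{5,p} + (p²−b₀p)c_{4,p})`, a quadratic functional
of the partial-fraction data of `R_b` alone (here through the canonical choice `pfData b`; `quadM3_eq` for any data). -/
def quadM3 (b : ℕ → ℤ) : ℚ :=
  coeffU b ^ 2 +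
      coeffU b * ∑ p ∈ range ((b 0).toNat + 1),
        (((b 0 : ℚ) - 2 * p) * pfData b 3 p + ((p : ℚ) ^ 2 - (b 0 : ℚ) * p) * pfData b 2 p) -
    coeffW b * ∑ p ∈ range ((b 0).toNat + 1),
        (((b 0 : ℚ) - 2 * p) * pfData b 5 p + ((p : ℚ) ^ 2 - (b 0 : ℚ) * p) * pfData b 4 p)

/-- `M₃(b)` computed from ANY partial-fraction data of `R_b`. -/
theorem quadM3_eq {b : ℕ → ℤ} {c : ℕ → ℕ → ℚ} (hc : IsPFData b c) :
    quadM3 b = coeffU b ^ 2 +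
      coeffU b * ∑ p ∈ range ((b 0).toNat + 1),
        (((b 0 : ℚ) - 2 * p) * c 3 p + ((p : ℚ) ^ 2 - (b 0 : ℚ) * p) * c 2 p) -
      coeffW b * ∑ p ∈ range ((b 0).toNat + 1),
        (((b 0 : ℚ) - 2 * p) * c 5 p + ((p : ℚ) ^ 2 - (b 0 : ℚ) * p) * c 4 p) := by
  have hsame : ∀ o, o < 6 → ∀ p ∈ range ((b 0).toNat + 1), pfData b o p = c o p := fun o ho p hp =>
    (isPFData_pfData hc).eq hc ho (Nat.lt_succ_iff.1 (mem_range.1 hp))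
  have h1 : ∑ p ∈ range ((b 0).toNat + 1),
      (((b 0 : ℚ) - 2 * p) * pfData b 3 p + ((p : ℚ) ^ 2 - (b 0 : ℚ) * p) * pfData b 2 p) =
      ∑ p ∈ range ((b 0).toNat + 1), (((b 0 : ℚ) - 2 * p) * c 3 p + ((p : ℚ) ^ 2 - (b 0 : ℚ) * p) * c 2 p) :=
    sum_congr rfl fun p hp => by rw [hsame 3 (by norm_num) p hp, hsame 2 (by norm_num) p hp]
  have h2 : ∑ p ∈ range ((b 0).toNat + 1),
      (((b 0 : ℚ) - 2 * p) * pfData b 5 p + ((p : ℚ) ^ 2 - (b 0 : ℚ) * p) * pfData b 4 p) =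
      ∑ p ∈ range ((b 0).toNat + 1), (((b 0 : ℚ) - 2 * p) * c 5 p + ((p : ℚ) ^ 2 - (b 0 : ℚ) * p) * c 4 p) :=
    sum_congr rfl fun p hp => by rw [hsame 5 (by norm_num) p hp, hsame 4 (by norm_num) p hp]
  unfold quadM3
  rw [h1, h2]

/-- **The j-FREE FORM of the minor** (DICTIONARY.md §2 (f), PROVED): for `b` in the box with `d(b) ≥ 0` and a partner
`i+1` with `b_{i+1} ≤ b₀`, `U(b)·W(b+e_{i+1}) − U(b+e_{i+1})·W(b) = M₃(b)`. -/
theorem wedgeQ_eq_quadM3 (b : ℕ → ℤ) (hb : InBox b) (hd : 0 ≤ dOf b) {i : ℕ} (hi : i ∈ range 7)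
    (hle : b (i + 1) ≤ b 0) :
    coeffU b * coeffW (Function.update b (i + 1) (b (i + 1) + 1)) -
        coeffU (Function.update b (i + 1) (b (i + 1) + 1)) * coeffW b = quadM3 b := by
  obtain ⟨c, hc⟩ := exists_isPFData b hb (sum_le_of_dOf b hd)
  rw [coeffW_update hb hd hi hle hc, coeffU_update hb hd hi hle hc, quadM3_eq hc]
  ring

/-- The same with the partner written `j ∈ [1,7]`, `b′ = Function.update b j (b j + 1)`. -/
theorem wedgeQ_eq_quadM3' (b : ℕ → ℤ) (hb : InBox b) (hd : 0 ≤ dOf b) {j : ℕ} (hj : j ∈ Icc 1 7)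
    (hle : b j ≤ b 0) :
    coeffU b * coeffW (Function.update b j (b j + 1)) -
        coeffU (Function.update b j (b j + 1)) * coeffW b = quadM3 b := by
  obtain ⟨i, rfl⟩ : ∃ i, j = i + 1 := ⟨j - 1, by have := (mem_Icc.1 hj).1; omega⟩
  have hi : i ∈ range 7 := by have := (mem_Icc.1 hj).2; exact mem_range.2 (by omega)
  exact wedgeQ_eq_quadM3 b hb hd hi hle

/-- **The `Q`-part of the conjecture in j-free form**: for `a` in the region of `wedgeDictionary` and an admissible
partner `j`, the first conjunct `Q(a) = ρ(U W′ − U′ W)` is EQUIVALENT to `Q(a) = ρ(a)·M₃(b(a))` — the binomial double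
sum (17) against a quadratic functional of the partial fractions of the single rational function `R_{b(a)}`. -/
theorem Q_part_iff_quadM3 (a : Fin 8 → ℤ) {j : ℕ} (hj : j ∈ Icc 1 7)
    (hreg : ∀ i ∈ Icc 1 7, 0 ≤ bOfA a i ∧ 2 * bOfA a i ≤ bOfA a 0 + 1) (hd : 0 ≤ dOf (bOfA a))
    (hpart : 2 * (bOfA a j + 1) ≤ bOfA a 0 + 1) :
    ((QOf a : ℚ) = rhoOf a * (coeffU (bOfA a) * coeffW (Function.update (bOfA a) j (bOfA a j + 1)) -
        coeffU (Function.update (bOfA a) j (bOfA a j + 1)) * coeffW (bOfA a))) ↔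
      (QOf a : ℚ) = rhoOf a * quadM3 (bOfA a) := by
  have hbox := inBox_of_region (bOfA a) hreg hj hpart
  have hle : bOfA a j ≤ bOfA a 0 := by have := (hreg j hj).1; linarith
  rw [wedgeQ_eq_quadM3' (bOfA a) hbox hd hj hle]

/-- Hence `wedgeDictionary` implies `Q(a) = ρ(a)·M₃(b(a))` on its region. -/
theorem Q_eq_rho_mul_quadM3_of_wedgeDictionary (hW : wedgeDictionary) (a : Fin 8 → ℤ) {j : ℕ}
    (hj : j ∈ Icc 1 7) (hconv : Converges a)
    (hreg : ∀ i ∈ Icc 1 7, 0 ≤ bOfA a i ∧ 2 * bOfA a i ≤ bOfA a 0 + 1) (hd : 0 ≤ dOf (bOfA a))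
    (hpart : 2 * (bOfA a j + 1) ≤ bOfA a 0 + 1) :
    (QOf a : ℚ) = rhoOf a * quadM3 (bOfA a) :=
  (Q_part_iff_quadM3 a hj hreg hd hpart).1 (hW a j hj hconv hreg hd hpart).1

end Summit.KontsevichZagierPeriods.Zeta5Search.WedgeDictionary
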